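import Literature.InformationTheory.Entanglement.IsotropicStateNegativity
import Literature.InformationTheory.Entanglement.NegativityTensorProduct
import HarnessLib

/-!
# The noisy singlet `ρ_p = pP_+ + (1−p)𝟙/m²`: `‖ρ_p^{T_A}‖₁ = mp + (1−p)/m` and `D(P_+, ρ_p) = 2(1−p)(m²−1)/m²
# = 2(1 − ‖ρ_p^{T_A}‖₁/m)` (Vidal–Werner 2002, § III.A)

Hodge foundations lane (`lit-hodgefound`, prover p24 gen 77; quantum-information series, sequel of
`IsotropicStateNegativity.lean`).  THEOREMS ONLY: no definition, no named fact, net debt 0; `‖A‖₁ = Σ_i|λ_i(A)|`.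

## Source, VERBATIM

G. Vidal, R. F. Werner, *Computable measure of entanglement*, Phys. Rev. A **65** (2002) 032314 [VidalWerner2002], § III.A
(held `paper:arxiv-quant-ph_0102117`, chunk p0008): «We can then assume that `P_opt(ρ)` has already undergone a twirling
operation. This means that it is a noisy singlet `ρ_p = pP_+ + (1−p) I⊗I/m²`, from which the absolute distance to `P_+` can
be easily computed, `D(P_+, ρ_p) = 2(1−p)(m²−1)/m²`. Similarly, the trace norm of `ρ_p^{T_A}` reads
`‖ρ_p^{T_A}‖₁ = mp + (1−p)/m`, and therefore `D(P_+, ρ_p) = 2(1 − ‖ρ_p^{T_A}‖₁/m)`.»  Here `D(ρ₁, ρ₂) ≡ ‖ρ₁ − ρ₂‖₁` is the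
absolute distance and `P_+ = |Φ^+⟩⟨Φ^+|`, `|Φ^+⟩ = m^{-1/2} Σ_α |α_A ⊗ α_B⟩`.

## Dictionary

`ρ_p` is the tree's isotropic state `PPT.rhoIsoD n p` (`m = |n|`), `P_+ = |maxEnt⟩⟨maxEnt|` with `PPT.maxEnt n`; `T_A`/`T_B`
give the same trace norm here (`Negativity.sum_negPart_eigenvalues_ptA_eq_ptB`); the printed `‖ρ_p^{T_A}‖₁ = mp + (1−p)/m`
holds in the NPT range `p ≥ 1/(m+1)` (for `p ≤ 1/(m+1)` the state is PPT and the norm is `1`), which is the range used in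
the paper (`P_opt(ρ)` at least as entangled as …); we state both ranges.

## What is formalized (all PROVED)

* `traceNorm_ptB_noisySinglet` / `traceNorm_ptA_noisySinglet` (`‖ρ_p^{T}‖₁ = mp + (1−p)/m` for `p(m+1) ≥ 1`),
  `traceNorm_ptB_noisySinglet_of_ppt` (`= 1` for `0 ≤ 1 + p(m−1)`, `p(m+1) ≤ 1`);
* `traceNorm_proj_sub_noisySinglet` (`D(P_+, ρ_p) = ‖P_+ − ρ_p‖₁ = 2(1−p)(m²−1)/m²` for `p ≤ 1`);
* `traceNorm_proj_sub_noisySinglet_eq` (`D(P_+, ρ_p) = 2(1 − ‖ρ_p^{T_A}‖₁/m)` for `1/(m+1) ≤ p ≤ 1`).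

NOT formalized: Proposition 4 itself (`Δ(P_+, ρ) ≥ 2(1 − (1 + 2𝒩(ρ))/m)`), which rests on the LOCC monotonicity of `𝒩`
and the twirling argument.

## Tree search (2026-08-31)

`rg -n "rhoIsoD" Literature/InformationTheory/Entanglement` → `WernerStateSeparability` (entries, marginals, thresholds),
`IsotropicStateNegativity` (g77: `𝒩(ρ_p)`); no trace-norm distances.  REUSED: `IsotropicStateNegativity.
{sum_negPart_eigenvalues_ptB_rhoIsoD, sum_negPart_eigenvalues_ptB_rhoIsoD_eq_zero}`, `Negativity.{sum_abs_eigenvalues_ptB,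
sum_abs_eigenvalues_ptA, sum_negPart_eigenvalues_ptA_eq_ptB, sum_abs_eigenvalues_le_trace_add_trace}`,
`NegativityTensorProduct.re_trace_mul_le_sum_abs_eigenvalues`, `PPT.{rhoIsoD, maxEnt, norm_maxEnt, trace_rhoIsoD}`.

presearch: «noisy singlet isotropic state trace norm partial transpose mp + (1−p)/m distance to maximally entangled state
2(1−p)(m²−1)/m²» → [corpus: arxiv quant-ph/0102117 § III.A]; galaxy `"noisy singlet|singlet distance"` (pdf) → VW only.

## References

* [VidalWerner2002] § III.A (the three displays before Proposition 4).
-/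

noncomputable section

open Matrix Finset
open scoped ComplexOrder

namespace Literature.InformationTheory.Entanglement.NoisySingletTraceNorms

open Literature.InformationTheory.Entanglement.PPT (ptA ptB rhoIsoD maxEnt norm_maxEnt trace_rhoIsoD)
open Literature.InformationTheory.Entanglement.Negativity (sum_abs_eigenvalues_ptB sum_abs_eigenvalues_ptA
  sum_negPart_eigenvalues_ptA_eq_ptB sum_abs_eigenvalues_le_trace_add_trace sum_abs_eigenvalues_eq_trace_add_two_mul)
open Literature.InformationTheory.Entanglement.NegativityTensorProduct (re_trace_mul_le_sum_abs_eigenvalues)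
open Literature.InformationTheory.Entanglement.IsotropicStateNegativity (sum_negPart_eigenvalues_ptB_rhoIsoD
  sum_negPart_eigenvalues_ptB_rhoIsoD_eq_zero)

variable {n : Type*} [Fintype n] [DecidableEq n] [Nonempty n]

/-! ## § 1. `‖ρ_p^{T}‖₁ = mp + (1−p)/m` -/

/-- **`‖ρ_p^{T_B}‖₁ = mp + (1−p)/m`** for the noisy singlet in the NPT range `p(m+1) ≥ 1`. [cite: VidalWerner2002, § III.A
(«the trace norm of `ρ_p^{T_A}` reads `‖ρ_p^{T_A}‖₁ = mp + (1−p)/m`»)] -/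
theorem traceNorm_ptB_noisySinglet {p : ℝ} (hp : 1 ≤ p * ((Fintype.card n : ℝ) + 1))
    (hH : (ptB (rhoIsoD n p)).IsHermitian) :
    ∑ i, |hH.eigenvalues i| = Fintype.card n * p + (1 - p) / Fintype.card n := by
  have hd : (0 : ℝ) < Fintype.card n := Nat.cast_pos.2 Fintype.card_pos
  rw [sum_abs_eigenvalues_ptB (trace_rhoIsoD p) hH, sum_negPart_eigenvalues_ptB_rhoIsoD hp hH]
  field_simp
  ring

/-- The same for `T_A` (as printed). [cite: VidalWerner2002, § III.A] -/
theorem traceNorm_ptA_noisySinglet {p : ℝ} (hp : 1 ≤ p * ((Fintype.card n : ℝ) + 1))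
    (hH : (ptA (rhoIsoD n p)).IsHermitian) (hHB : (ptB (rhoIsoD n p)).IsHermitian) :
    ∑ i, |hH.eigenvalues i| = Fintype.card n * p + (1 - p) / Fintype.card n := by
  rw [sum_abs_eigenvalues_ptA (trace_rhoIsoD p) hH, sum_negPart_eigenvalues_ptA_eq_ptB _ hH hHB,
    ← sum_abs_eigenvalues_ptB (trace_rhoIsoD p) hHB]
  exact traceNorm_ptB_noisySinglet hp hHB

/-- In the PPT range the trace norm of `ρ_p^{T_B}` is `1`. [cite: VidalWerner2002, § II.A (after eq. (4): `‖ρ_s^{T_A}‖₁ = 1`)] -/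
theorem traceNorm_ptB_noisySinglet_of_ppt {p : ℝ} (hlo : 0 ≤ 1 + p * ((Fintype.card n : ℝ) - 1))
    (hhi : p * ((Fintype.card n : ℝ) + 1) ≤ 1) (hH : (ptB (rhoIsoD n p)).IsHermitian) :
    ∑ i, |hH.eigenvalues i| = 1 := by
  rw [sum_abs_eigenvalues_ptB (trace_rhoIsoD p) hH, sum_negPart_eigenvalues_ptB_rhoIsoD_eq_zero hlo hhi hH, mul_zero,
    add_zero]

/-! ## § 2. `D(P_+, ρ_p) = ‖P_+ − ρ_p‖₁ = 2(1−p)(m²−1)/m²` -/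

/-- `P_+ = |Φ^+⟩⟨Φ^+|` is a projector: `P_+² = P_+`. [folklore] -/
private theorem proj_maxEnt_mul_self :
    vecMulVec (maxEnt n) (star (maxEnt n)) * vecMulVec (maxEnt n) (star (maxEnt n)) =
      vecMulVec (maxEnt n) (star (maxEnt n)) := by
  rw [vecMulVec_mul_vecMulVec, norm_maxEnt, one_smul]

/-- `Tr P_+ = 1`. [folklore] -/
private theorem trace_proj_maxEnt : (vecMulVec (maxEnt n) (star (maxEnt n))).trace = 1 := by
  rw [trace_vecMulVec, dotProduct_comm, norm_maxEnt]

omit [Nonempty n] in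
/-- `P_+ − ρ_p = (1−p)(1 − 1/m²) P_+ − ((1−p)/m²)(𝟙 − P_+)`. [cite: VidalWerner2002, § III.A (`ρ_p = pP_+ + (1−p)I⊗I/m²`)] -/
private theorem proj_sub_noisySinglet_eq (p : ℝ) :
    vecMulVec (maxEnt n) (star (maxEnt n)) - rhoIsoD n p =
      (((1 - p) * (1 - 1 / (Fintype.card n : ℝ) ^ 2) : ℝ) : ℂ) • vecMulVec (maxEnt n) (star (maxEnt n)) -
        (((1 - p) / (Fintype.card n : ℝ) ^ 2 : ℝ) : ℂ) • ((1 : Matrix (n × n) (n × n) ℂ) - vecMulVec (maxEnt n) (star (maxEnt n))) := by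
  rw [rhoIsoD, smul_sub]
  push_cast
  module

/-- `𝟙 − P_+` is a projector, hence `⪰ 0`; `P_+(𝟙 − P_+) = 0`; `Tr(𝟙 − P_+) = m² − 1`. [folklore] -/
private theorem one_sub_proj_facts :
    ((1 : Matrix (n × n) (n × n) ℂ) - vecMulVec (maxEnt n) (star (maxEnt n))).PosSemidef ∧
      vecMulVec (maxEnt n) (star (maxEnt n)) * ((1 : Matrix (n × n) (n × n) ℂ) - vecMulVec (maxEnt n) (star (maxEnt n))) = 0 ∧
      ((1 : Matrix (n × n) (n × n) ℂ) - vecMulVec (maxEnt n) (star (maxEnt n))) *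
          ((1 : Matrix (n × n) (n × n) ℂ) - vecMulVec (maxEnt n) (star (maxEnt n))) =
        (1 : Matrix (n × n) (n × n) ℂ) - vecMulVec (maxEnt n) (star (maxEnt n)) ∧
      (((1 : Matrix (n × n) (n × n) ℂ) - vecMulVec (maxEnt n) (star (maxEnt n))).trace).re = (Fintype.card n : ℝ) ^ 2 - 1 := by
  have hP := proj_maxEnt_mul_self (n := n)
  have hPh : (vecMulVec (maxEnt n) (star (maxEnt n)))ᴴ = vecMulVec (maxEnt n) (star (maxEnt n)) := by
    rw [conjTranspose_vecMulVec, star_star]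
  have hQQ : ((1 : Matrix (n × n) (n × n) ℂ) - vecMulVec (maxEnt n) (star (maxEnt n))) *
      ((1 : Matrix (n × n) (n × n) ℂ) - vecMulVec (maxEnt n) (star (maxEnt n))) =
      (1 : Matrix (n × n) (n × n) ℂ) - vecMulVec (maxEnt n) (star (maxEnt n)) := by
    rw [sub_mul, one_mul, Matrix.mul_sub, Matrix.mul_one, hP, sub_self, sub_zero]
  refine ⟨?_, ?_, hQQ, ?_⟩
  · rw [show (1 : Matrix (n × n) (n × n) ℂ) - vecMulVec (maxEnt n) (star (maxEnt n)) =
        ((1 : Matrix (n × n) (n × n) ℂ) - vecMulVec (maxEnt n) (star (maxEnt n)))ᴴ *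
        ((1 : Matrix (n × n) (n × n) ℂ) - vecMulVec (maxEnt n) (star (maxEnt n))) by
          rw [conjTranspose_sub, conjTranspose_one, hPh, hQQ]]
    exact posSemidef_conjTranspose_mul_self _
  · rw [Matrix.mul_sub, Matrix.mul_one, hP, sub_self]
  · rw [trace_sub, trace_one, trace_proj_maxEnt, Fintype.card_prod, Complex.sub_re, Complex.natCast_re, Complex.one_re]
    push_cast
    ring

/-- **`D(P_+, ρ_p) = ‖P_+ − ρ_p‖₁ = 2(1−p)(m²−1)/m²`** for `p ≤ 1` («the absolute distance to `P_+` can be easily computed»;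
upper bound from the decomposition along `P_+`, `𝟙 − P_+`, lower bound from the symmetry `2P_+ − 𝟙`).
[cite: VidalWerner2002, § III.A] -/
theorem traceNorm_proj_sub_noisySinglet {p : ℝ} (hp : p ≤ 1)
    (hH : (vecMulVec (maxEnt n) (star (maxEnt n)) - rhoIsoD n p).IsHermitian) :
    ∑ i, |hH.eigenvalues i| = 2 * (1 - p) * ((Fintype.card n : ℝ) ^ 2 - 1) / (Fintype.card n : ℝ) ^ 2 := by
  have hd : (0 : ℝ) < Fintype.card n := Nat.cast_pos.2 Fintype.card_pos
  have hd1 : (1 : ℝ) ≤ Fintype.card n := Nat.one_le_cast.2 Fintype.card_pos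
  obtain ⟨hQ, hPQ, hQQ, hQtr⟩ := one_sub_proj_facts (n := n)
  have hPpsd : (vecMulVec (maxEnt n) (star (maxEnt n))).PosSemidef := posSemidef_vecMulVec_self_star _
  have hP := proj_maxEnt_mul_self (n := n)
  have hdec := proj_sub_noisySinglet_eq (n := n) p
  have hc1 : 0 ≤ (1 - p) * (1 - 1 / (Fintype.card n : ℝ) ^ 2) := by
    refine mul_nonneg (by linarith) ?_
    rw [sub_nonneg, div_le_one (by positivity)]
    nlinarith
  have hc2 : 0 ≤ (1 - p) / (Fintype.card n : ℝ) ^ 2 := div_nonneg (by linarith) (by positivity)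
  have hval : (1 - p) * (1 - 1 / (Fintype.card n : ℝ) ^ 2) * 1 + (1 - p) / (Fintype.card n : ℝ) ^ 2 *
      ((Fintype.card n : ℝ) ^ 2 - 1) = 2 * (1 - p) * ((Fintype.card n : ℝ) ^ 2 - 1) / (Fintype.card n : ℝ) ^ 2 := by
    field_simp
    ring
  refine le_antisymm ?_ ?_
  · calc ∑ i, |hH.eigenvalues i|
        ≤ ((((1 - p) * (1 - 1 / (Fintype.card n : ℝ) ^ 2) : ℝ) : ℂ) • vecMulVec (maxEnt n) (star (maxEnt n))).trace.re +
          ((((1 - p) / (Fintype.card n : ℝ) ^ 2 : ℝ) : ℂ) •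
            ((1 : Matrix (n × n) (n × n) ℂ) - vecMulVec (maxEnt n) (star (maxEnt n)))).trace.re :=
          sum_abs_eigenvalues_le_trace_add_trace hH (hPpsd.smul (Complex.zero_le_real.2 hc1))
            (hQ.smul (Complex.zero_le_real.2 hc2)) hdec
      _ = _ := by
          rw [trace_smul, trace_smul, trace_proj_maxEnt, smul_eq_mul, smul_eq_mul, mul_one, Complex.ofReal_re,
            Complex.re_ofReal_mul, hQtr, ← hval, mul_one]
  · -- the symmetry `S = P_+ − (𝟙 − P_+)`
    have hS : (vecMulVec (maxEnt n) (star (maxEnt n)) -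
        ((1 : Matrix (n × n) (n × n) ℂ) - vecMulVec (maxEnt n) (star (maxEnt n)))).IsHermitian :=
      hPpsd.isHermitian.sub hQ.isHermitian
    have hQP : ((1 : Matrix (n × n) (n × n) ℂ) - vecMulVec (maxEnt n) (star (maxEnt n))) *
        vecMulVec (maxEnt n) (star (maxEnt n)) = 0 := by
      rw [sub_mul, one_mul, hP, sub_self]
    have hS2 : (vecMulVec (maxEnt n) (star (maxEnt n)) -
        ((1 : Matrix (n × n) (n × n) ℂ) - vecMulVec (maxEnt n) (star (maxEnt n)))) *
        (vecMulVec (maxEnt n) (star (maxEnt n)) -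
        ((1 : Matrix (n × n) (n × n) ℂ) - vecMulVec (maxEnt n) (star (maxEnt n)))) = 1 := by
      simp only [Matrix.sub_mul, Matrix.mul_sub, Matrix.one_mul, Matrix.mul_one, hP]
      abel
    have h := re_trace_mul_le_sum_abs_eigenvalues hH hS hS2
    have htr : ((vecMulVec (maxEnt n) (star (maxEnt n)) - rhoIsoD n p) *
        (vecMulVec (maxEnt n) (star (maxEnt n)) -
          ((1 : Matrix (n × n) (n × n) ℂ) - vecMulVec (maxEnt n) (star (maxEnt n))))).trace.re =
        2 * (1 - p) * ((Fintype.card n : ℝ) ^ 2 - 1) / (Fintype.card n : ℝ) ^ 2 := by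
      have hXS : ((((1 - p) * (1 - 1 / (Fintype.card n : ℝ) ^ 2) : ℝ) : ℂ) • vecMulVec (maxEnt n) (star (maxEnt n)) -
          (((1 - p) / (Fintype.card n : ℝ) ^ 2 : ℝ) : ℂ) •
            ((1 : Matrix (n × n) (n × n) ℂ) - vecMulVec (maxEnt n) (star (maxEnt n)))) *
          (vecMulVec (maxEnt n) (star (maxEnt n)) -
            ((1 : Matrix (n × n) (n × n) ℂ) - vecMulVec (maxEnt n) (star (maxEnt n)))) =
          (((1 - p) * (1 - 1 / (Fintype.card n : ℝ) ^ 2) : ℝ) : ℂ) • vecMulVec (maxEnt n) (star (maxEnt n)) +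
          (((1 - p) / (Fintype.card n : ℝ) ^ 2 : ℝ) : ℂ) •
            ((1 : Matrix (n × n) (n × n) ℂ) - vecMulVec (maxEnt n) (star (maxEnt n))) := by
        simp only [Matrix.sub_mul, Matrix.mul_sub, Matrix.smul_mul, Matrix.one_mul, Matrix.mul_one, hP]
        module
      rw [hdec, hXS, trace_add, trace_smul, trace_smul, trace_proj_maxEnt, smul_eq_mul, smul_eq_mul, mul_one,
        Complex.add_re, Complex.ofReal_re, Complex.re_ofReal_mul, hQtr, ← hval, mul_one]
    rw [htr] at h
    exact h

/-- **`D(P_+, ρ_p) = 2(1 − ‖ρ_p^{T_A}‖₁/m)`** for `1/(m+1) ≤ p ≤ 1`. [cite: VidalWerner2002, § III.A] -/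
theorem traceNorm_proj_sub_noisySinglet_eq {p : ℝ} (hp : 1 ≤ p * ((Fintype.card n : ℝ) + 1)) (hp1 : p ≤ 1)
    (hH : (vecMulVec (maxEnt n) (star (maxEnt n)) - rhoIsoD n p).IsHermitian)
    (hHA : (ptA (rhoIsoD n p)).IsHermitian) (hHB : (ptB (rhoIsoD n p)).IsHermitian) :
    ∑ i, |hH.eigenvalues i| = 2 * (1 - (∑ i, |hHA.eigenvalues i|) / Fintype.card n) := by
  have hd : (0 : ℝ) < Fintype.card n := Nat.cast_pos.2 Fintype.card_pos
  rw [traceNorm_proj_sub_noisySinglet hp1 hH, traceNorm_ptA_noisySinglet hp hHA hHB]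
  field_simp
  ring

end Literature.InformationTheory.Entanglement.NoisySingletTraceNorms
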